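import Literature.AlgebraicGeometry.AbelianSchemes.SerreTensorRecognitionOfPoints          -- ★ KER-EQ §1–§2 (points ⇒ `T`-points, `c` finite ∕ flat)
import Literature.AlgebraicGeometry.AbelianSchemes.AbelianSchemeHomDescentFlatSurjective   -- ★ descent through `c`
import Literature.AlgebraicGeometry.AbelianSchemes.AbelianSchemeHomDescentEquivariant      -- ★ `cancel_left_of_flat_surjective`
import Literature.AlgebraicGeometry.AbelianSchemes.AbelianSchemeHomDescentPolarized        -- ★ `cancel_right_of_comp_eq_pow_id`
import Literature.AlgebraicGeometry.AbelianSchemes.AbelianSchemeDualRingAction             -- ★ `RingAction.dual`, `dualIsogenyOver_id'`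
import Literature.AlgebraicGeometry.AbelianSchemes.DualIsogenyMul                          -- ★ `dualIsogenyOver_mul`
import Literature.AlgebraicGeometry.AbelianSchemes.DualIsogenyMulN                         -- ★ `dualIsogenyOver_mulN`
import Literature.AlgebraicGeometry.AbelianSchemes.AbelianSchemeDualIsogenyComp            -- ★ `dualIsogenyOver_comp`
import Literature.AlgebraicGeometry.AbelianSchemes.IdealTorsionPointCountAlgClosedField    -- ★ (LAT-C) `#A[𝔞](Ω̄) = N𝔞²`
import Literature.AlgebraicGeometry.AbelianSchemes.PolarizationUnitHypothesis              -- ★ `Polarization.nonempty_unitHatSlice_iso`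
import Literature.AlgebraicGeometry.AbelianSchemes.SerreTensorIsogeny                      -- ★ `RingAction.i_natCast`
import Literature.AlgebraicGeometry.Motives.AlgPointsMapSurjectiveAlgClosed                -- ★ `pow_surjective_of_isAlgClosed`, points lift
import Literature.NumberTheory.NumberFields.SerreTensorPresentationOfIdeal                 -- ★ `exists_serrePresentation_of_ideal`
import Literature.NumberTheory.Automorphic.GaloisActionPlaces                              -- ★ `g • w` on `HeightOneSpectrum`
import Mathlib.NumberTheory.NumberField.CMField
import HarnessLib

/-!
# The kernel of a `p`-isogeny roof leg is killed by `𝔭_w 𝔭_{c•w}` — the shape `Ker q ⊆ A[𝔭_w𝔭_{c•w}]` of the moduli quotient kernel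
# ([Liu2021] Prop. D.8; [MumfordAV1970] §7, §15, §23; [Shimura1998] §13.1)

Topic `AlgebraicGeometry/AbelianSchemes`, namespace `Literature.AlgebraicGeometry.AbelianSchemes.AbelianSchemeOver`.  THEOREMS ONLY (no definition, no named
fact, no `instance`, no notation, no `sorry`).  Cell `hodgecm-mathlib` (D-0151), F0∕P6 «MOD», «GO 500» line L2 (socket `stub_DOWN`), organ (ρ2″) «ROOF KERNEL SHAPE
UPSTAIRS» (LA2-plan (g0) deal 2026-09-02T05:46:25Z, RULING «ρ-ROAD v2.1» 06:01:31Z; LAref-D (g0) «M-69» (β)): the (r0) clause «`Ker q ⊆ A_y[𝔭_w·𝔭_{c•w}]`» DERIVED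
from the isogeny roof `A_y —q→ B ←c— A_{y″}` of the P6a letter `RoofΩ` — so no interface change is needed; its downstairs shadow (r0₀) is the no-banal-part hypothesis of
the (ρ2)∕(BLK) pens.  `--supports stmt-HodgeConjecture-24832`, count-neutral.  HONEST LABEL: HC_CM is proved only modulo the cell's 2 remaining named inputs
(hLiu418 24832, h413 24833) until rung 0 closes; this file discharges none of them.

## Mathematics (pairing-free; all on `Ω̄`-points, `char Ω̄ = 0`)

`F` a CM field with complex conjugation `c`, `w` a finite place with `𝔭̄ := 𝔭_{c•w} ≠ 𝔭_w`, both over the rational prime `p`, and `p` UNRAMIFIED at `w` and at `c•w`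
(`hunr`, [Liu2021] p. 134: «`p` is unramified in `E`»), so that `(p) = 𝔭_w 𝔭̄ 𝔟` with `𝔟` (the BANAL part) coprime to `𝔭_w` and to `𝔭̄`.  Over `Ω = Ω̄ ↪ ℂ`: abelian
schemes `A, A″` with `𝓞 F`-actions, `A″` of relative dimension `[F:ℚ]`; dual pairs and a polarisation `λ` of `A` QUASI-INVERTIBLE PRIME TO `p` (`λ ≫ ν = [d]`, `p ∤ d`); a
Rosati polarisation `λ″` of `A″` (`ι″(b̄) ≫ λ″ = λ″ ≫ ι″(b)^∨`); a ROOF `A —q→ B ←c— A″` (`B` with a normalised dual pair and a homomorphism `λ_B : B → B^`) with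
(r1) `Ker q(Ω) = K`, (r2) `Ker c(Ω) = A″[𝔭_w](Ω)` and `c` surjective, (r3) `q^*λ_B = p·λ`, `c^*λ_B = p·λ″`, (r4) `q`, `c` equivariant for a common `b_a ∈ End B`; and the
DEGREE CLAUSE `#K = #A″[𝔭_w](Ω)` (necessary, see LAref-D (iii): it kills the `ℓ`-parts).  THEN `K ⊆ A[𝔭_w𝔭̄](Ω)`.
(1) `K ⊆ A[p]`: `#K = N𝔭_w² ∣ p^{2[F:ℚ]}` (★ count), and `x ∈ K ⇒ (x ≫ λ)^p = x ≫ q ≫ λ_B ≫ q^∨ = 1 ⇒ x^{pd} = 1`; `gcd(pd, p^N) ∣ p`.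
(2) With `u ∈ 𝔭_w𝔭̄`, `u ≡ 1 (𝔟)`: `x_𝔟 := x ≫ ι(u) ∈ K ∩ A[𝔟]` and `x ∕ x_𝔟 ∈ A[𝔭_w𝔭̄]` (`(1-u)·𝔭_w𝔭̄ ⊆ 𝔭_w𝔭̄𝔟 = (p)`), so it suffices that **`K ∩ A[𝔟] = 1`** (THE BANAL
LEMMA): for `x ∈ K ∩ A[𝔟]` take `t ∈ A[𝔟²]` with `t^p = x` (divisibility + the projector `ι(u²-…)`), `y ∈ A″[𝔟³]` with `y ≫ c = t ≫ q` (`c` onto on points + projector;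
`(y^p) ≫ c = x ≫ q = 1` ⇒ `y^p ∈ A″[𝔭_w] ∩ A″[𝔟³] = 1`), `y₁ ∈ A″[𝔟²]` with `y₁^p = y`, and `ζ := y₁ ≫ c ≫ λ_B`; then `ζ ≫ c^∨ = y ≫ λ″`, `ζ^p = t ≫ q ≫ λ_B`, so
`ζ^p ≫ c^∨ = (y ≫ λ″)^p = 1` — and `Ker c^∨` is killed by `b(𝔭_w)^∨` (for `r ∈ 𝔭_w`, `ι″(r)` descends through `c` to `g_r` with `g_r ≫ c = b_r`, so `b_r^∨ = c^∨ ≫ g_r^∨`),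
while `ζ^p = (t ≫ q) ≫ λ_B` is killed by `b(c𝔟²)^∨` (Rosati for `λ_B`, obtained from Rosati at `A″` by cancelling `c`, `c^∨`); `𝔭_w + c𝔟² = 𝒪` ⇒ `ζ^p = 1` ⇒
`(x ≫ λ) = (t ≫ λ)^p = ζ^p ≫ q^∨ = 1` ⇒ `x^d = 1 = x^p` ⇒ `x = 1`.  (Lattice picture: `T_v ⊆ T″_v ⊆ (T″_{v̄})^* ⊆ (T_{v̄})^* = T_v` at a banal `v`: unimodularity of `λ` at
`A` and integrality of `λ″` — NOT isotropy, which cannot see banal blocks.)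

## Contents
* §1 bookkeeping for an `𝒪`-action on points (`comp_eq_one_of_forall_mem_sup_eq_top`, `comp_i_eq_self_of_sub_one_mem`, `forall_mem_span_natCast_of_pow_eq_one`, …).
* §2 **`isIdealTorsion_mul_of_roof`** — THE HEAD (consumer-shaped: the rows of `RoofΩ` after `obtain`, in its token shapes).

* (ED. 3) `map_i_mem_of_roof` — the roof kernel `K` is `ι`-stable (the common endomorphisms `b_a` are homomorphisms after the faithfully flat `c`).

## References
* [Liu2021] Y. Liu, *Fourier–Jacobi cycles and arithmetic relative trace formula*, Camb. J. Math. 9 (2021), App. D, Prop. D.8 (p. 135), pp. 134–138.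
* [MumfordAV1970] D. Mumford, *Abelian Varieties* (1970), §7 Thm. 4 (p. 72), §15 Thm. 1 (p. 143), §23 (p. 231).
* [Shimura1998] G. Shimura, *Abelian varieties with complex multiplication and modular functions* (1998), §13.1 Thm. 1 (pp. 97–99), §7.5 (p. 72).
* [RapoportSmithlingZhang2020Diagonal] M. Rapoport, B. Smithling, W. Zhang (2020), Lemma 3.4–Prop. 3.7 (pp. 12–14), §4.3 (4.23) (p. 21).
-/

set_option autoImplicit false

noncomputable section

set_option backward.isDefEq.respectTransparency false

open CategoryTheory CategoryTheory.Limits AlgebraicGeometry MonoidalCategory CartesianMonoidalCategory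
open scoped MonObj CategoryTheory.Obj NumberField Pointwise
open IsDedekindDomain NumberField
open Literature.AlgebraicGeometry.Motives (AlgPoints SchemeOver specOver)

namespace Literature.AlgebraicGeometry.AbelianSchemes

namespace AbelianSchemeOver

universe u

/-! ## §1 Bookkeeping: an `𝒪`-action on `T`-points -/

section Bookkeeping

variable {S : Scheme.{u}} {A : AbelianSchemeOver S} {O : Type*} [CommRing O] (act : A.RingAction O) {T : Over S}

/-- A point killed by two COMAXIMAL ideals is trivial: `1 = u + v`, `x = x ≫ ι(1) = (x ≫ ι u)·(x ≫ ι v) = 1`. [cite: MumfordAV1970, §19 Thm. 3 (p. 176)] -/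
theorem comp_eq_one_of_forall_mem_sup_eq_top (x : T ⟶ A.X) {I J : Ideal O} (hI : ∀ a ∈ I, x ≫ act.i a = 1) (hJ : ∀ a ∈ J, x ≫ act.i a = 1)
    (hIJ : I ⊔ J = ⊤) : x = 1 := by
  obtain ⟨u, hu, v, hv, huv⟩ := Submodule.mem_sup.mp ((Ideal.eq_top_iff_one _).mp hIJ)
  have h1 : x ≫ act.i 1 = x := (act.comp_i_zero_one x).2
  rw [← h1, ← huv, act.comp_i_add, hI u hu, hJ v hv, mul_one]

/-- `x ≫ ι(u) = x` when `u - 1` kills `x`. [cite: MumfordAV1970, §19 Thm. 3 (p. 176)] -/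
theorem comp_i_eq_self_of_sub_one_mem (x : T ⟶ A.X) {J : Ideal O} (hJ : ∀ a ∈ J, x ≫ act.i a = 1) {u : O} (hu : u - 1 ∈ J) :
    x ≫ act.i u = x := by
  have h : u = (u - 1) + 1 := (sub_add_cancel u 1).symm
  rw [h, act.comp_i_add, hJ _ hu, one_mul]
  exact (act.comp_i_zero_one x).2

/-- `(x ≫ ι u) ≫ ι b = 1` when `u * b` lies in an ideal killing `x`. [cite: MumfordAV1970, §19 Thm. 3 (p. 176)] -/
theorem comp_i_comp_i_eq_one_of_mul_mem (x : T ⟶ A.X) {M : Ideal O} (hM : ∀ m ∈ M, x ≫ act.i m = 1) {u b : O} (h : u * b ∈ M) :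
    (x ≫ act.i u) ≫ act.i b = 1 := by
  rw [Category.assoc, ← act.i_mul, mul_comm, hM _ h]

/-- The points projected by `ι(u)`, `u ∈ I`, are killed by every `J` with `I * J ⊆ M`, `M` killing `x`. [cite: MumfordAV1970, §19 Thm. 3 (p. 176)] -/
theorem forall_mem_comp_i_comp_i_eq_one (x : T ⟶ A.X) {M I J : Ideal O} (hM : ∀ m ∈ M, x ≫ act.i m = 1) (hIJ : I * J ≤ M) {u : O}
    (hu : u ∈ I) : ∀ b ∈ J, (x ≫ act.i u) ≫ act.i b = 1 := fun _ hb =>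
  comp_i_comp_i_eq_one_of_mul_mem act x hM (hIJ (Ideal.mul_mem_mul hu hb))

/-- `x ≫ ι(N) = x ^ N` for a natural number `N`. [cite: MumfordAV1970, §19 Thm. 3 (p. 176)] -/
theorem comp_i_natCast (x : T ⟶ A.X) (N : ℕ) : x ≫ act.i (N : O) = x ^ N := by
  rw [RingAction.i_natCast, MonObj.comp_pow, Category.comp_id]

/-- An `N`-torsion point is killed by the ideal `(N)`. [cite: MumfordAV1970, §19 Thm. 3 (p. 176)] -/
theorem forall_mem_span_natCast_of_pow_eq_one (x : T ⟶ A.X) {N : ℕ} (hx : x ^ N = 1) :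
    ∀ m ∈ Ideal.span {((N : ℕ) : O)}, x ≫ act.i m = 1 := by
  intro m hm
  obtain ⟨r, rfl⟩ := Ideal.mem_span_singleton'.mp hm
  haveI := act.isMonHom r
  rw [act.comp_i_mul, comp_i_natCast act x N, hx, MonObj.one_comp]

end Bookkeeping

/-! ## §2 The roof over `Ω = Ω̄` of characteristic `0`: `Ker q ⊆ A[𝔭_w 𝔭_{c•w}]` -/

section Roof

variable {F : Type} [Field F] [NumberField F] [IsCMField F]
  {Ω : Type} [Field Ω] [IsAlgClosed Ω] [CharZero Ω]
  {A A'' B : AbelianSchemeOver (Spec (.of Ω))}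
  (act : A.RingAction (𝓞 F)) (act'' : A''.RingAction (𝓞 F))
  (D : A.DualPair) (pol : A.Polarization D) (D'' : A''.DualPair) (pol'' : A''.Polarization D'')
  (DB : B.DualPair) (lamB : B.X ⟶ DB.hat.X) [IsMonHom lamB]
  (q : A.X ⟶ B.X) [IsMonHom q] (c : A''.X ⟶ B.X) [IsMonHom c]

set_option maxHeartbeats 400000 in
/-- **THE KERNEL OF A `p`-ISOGENY ROOF LEG IS KILLED BY `𝔭_w·𝔭_{c•w}`.**  `F` CM, `c•w ≠ w`, `p ∈ 𝔭_w` UNRAMIFIED at `w` and at `c•w`; over `Ω = Ω̄ ↪ ℂ` of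
characteristic `0`: abelian schemes `A, A″` with `𝓞 F`-actions, `A″` of relative dimension `[F:ℚ]`, a polarisation `λ` of `A` quasi-invertible prime to `p`, a ROSATI
polarisation `λ″` of `A″`; a roof `A —q→ B ←c— A″` (`B` with a normalised dual pair and a homomorphism `λ_B`) with (r1) `Ker q(Ω) = K`, (r2) `Ker c(Ω) = A″[𝔭_w](Ω)`, `c`
surjective, (r3) `q^*λ_B = p·λ`, `c^*λ_B = p·λ″`, (r4) common equivariance; the degree clause `#K = #A″[𝔭_w](Ω)`.  THEN every `P ∈ K` is killed by `ι(𝔭_w·𝔭_{c•w})`.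
(The rows are the conjuncts of the P6a letter `RoofΩ` after `obtain`, in its own token shapes; proof in the module docstring — pairing-free.)
[cite: Liu2021, Prop. D.8 (p. 135), pp. 134–138] [cite: MumfordAV1970, §7 Thm. 4 (p. 72), §15 Thm. 1 (p. 143), §23 (p. 231)] [cite: Shimura1998, §13.1 Thm. 1 (pp. 97–99)] -/
theorem isIdealTorsion_mul_of_roof
    -- the place, its conjugate and the prime (unramified at both)
    (w : HeightOneSpectrum (𝓞 F)) (hw : (IsCMField.complexConj F) • w ≠ w)
    {p : ℕ} (hp : p.Prime) (hpw : (p : 𝓞 F) ∈ w.asIdeal)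
    (hunr : ¬ w.asIdeal ^ 2 ∣ Ideal.span {(p : 𝓞 F)}) (hunr' : ¬ ((IsCMField.complexConj F) • w).asIdeal ^ 2 ∣ Ideal.span {(p : 𝓞 F)})
    -- the field `Ω ↪ ℂ` and the relative dimension of `A″` (the ★ count `#A″[𝔞](Ω) = N𝔞²`)
    (σ : Ω →+* ℂ) (hA'' : A''.IsOfRelDim (Module.finrank ℚ F))
    -- the normalisation of `B̂`'s Poincaré sheaf (the J12 pin of `RoofΩ`)
    (hDB : Nonempty ((Scheme.Modules.pullback DB.unitHatSlice).obj DB.P ≅ SheafOfModules.unit _))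
    -- the kernel of `q` on `Ω`-points
    (K : Subgroup (A.toAffine.toAbelianVariety.Points Ω))
    -- (r1) kernel of `q` on `Ω`-points
    (h1 : ∀ P : A.toAffine.toAbelianVariety.Points Ω,
      (AlgPoints.map q P : B.toAffine.toAbelianVariety.Points Ω) = 1 ↔ P ∈ K)
    -- (r2) kernel of `c` on `Ω`-points = the `𝔭_w`-torsion; `c` surjective
    (h2 : ∀ P : A''.toAffine.toAbelianVariety.Points Ω,
      (AlgPoints.map c P : B.toAffine.toAbelianVariety.Points Ω) = 1 ↔
        ∀ a ∈ w.asIdeal, (AlgPoints.map (act''.i a) P : A''.toAffine.toAbelianVariety.Points Ω) = 1)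
    (h2s : Function.Surjective c.left.base)
    -- (r3) polarisations: `q^* λ_B = p • λ`, `c^* λ_B = p • λ″`
    (h3 : q ≫ lamB ≫ DualPair.dualIsogenyOver q D DB = pol.lam ≫ D.hat.mulN p)
    (h3'' : c ≫ lamB ≫ DualPair.dualIsogenyOver c D'' DB = pol''.lam ≫ D''.hat.mulN p)
    -- (r4) `𝒪_F`-equivariance through a common endomorphism of `B`
    (h4 : ∀ a : 𝓞 F, ∃ b : B.X ⟶ B.X, act.i a ≫ q = q ≫ b ∧ act''.i a ≫ c = c ≫ b)
    -- ROSATI at `A″`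
    (hros'' : ∀ b b' : 𝓞 F, (b' : F) = (IsCMField.complexConj F) (b : F) →
      haveI := act''.isMonHom b
      act''.i b' ≫ pol''.lam = pol''.lam ≫ DualPair.dualIsogenyOver (act''.i b) D'' D'')
    -- (P-1) at `A`: the polarisation is quasi-invertible prime to `p`
    (hν : ∃ (d : ℕ) (ν : D.hat.X ⟶ A.X), IsMonHom ν ∧ p.Coprime d ∧ pol.lam ≫ ν = A.mulN d)
    -- the DEGREE CLAUSE: the two legs have the same degree
    (hdeg : Nat.card ↥K = Nat.card {P : A''.toAffine.toAbelianVariety.Points Ω //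
      ∀ a ∈ w.asIdeal, (AlgPoints.map (act''.i a) P : A''.toAffine.toAbelianVariety.Points Ω) = 1}) :
    ∀ P ∈ K, ∀ a ∈ w.asIdeal * ((IsCMField.complexConj F) • w).asIdeal,
      (AlgPoints.map (act.i a) P : A.toAffine.toAbelianVariety.Points Ω) = 1 := by
  classical
  -- ===================== 0. INSTANCES, NORMALISATIONS, NOTATION =====================
  haveI : Fact p.Prime := ⟨hp⟩
  haveI : IsCommMonObj A.X := A.isCommMonObj_of_isReduced_base
  haveI : IsCommMonObj A''.X := A''.isCommMonObj_of_isReduced_base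
  haveI : IsCommMonObj B.X := B.isCommMonObj_of_isReduced_base
  haveI hpol := pol.isMonHom
  haveI hpol'' := pol''.isMonHom
  have hD := pol.nonempty_unitHatSlice_iso
  have hD'' := pol''.nonempty_unitHatSlice_iso
  haveI hqd : IsMonHom (DualPair.dualIsogenyOver q D DB) := DualPair.isMonHom_dualIsogenyOver q D DB hDB hD
  haveI hcd : IsMonHom (DualPair.dualIsogenyOver c D'' DB) := DualPair.isMonHom_dualIsogenyOver c D'' DB hDB hD''
  haveI : Surjective c.left := ⟨h2s⟩
  -- the two prime ideals and the conjugation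
  set 𝔭 : Ideal (𝓞 F) := w.asIdeal with h𝔭def
  set 𝔮 : Ideal (𝓞 F) := ((IsCMField.complexConj F) • w).asIdeal with h𝔮def
  have h𝔮𝔭 : 𝔮 = (IsCMField.complexConj F) • 𝔭 := rfl
  have h𝔭𝔮ne : 𝔭 ≠ 𝔮 := fun h => hw (HeightOneSpectrum.ext h.symm)
  haveI : 𝔭.IsMaximal := w.isMaximal
  haveI : 𝔮.IsMaximal := ((IsCMField.complexConj F) • w).isMaximal
  have hp𝔮 : (p : 𝓞 F) ∈ 𝔮 := by
    rw [h𝔮𝔭]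
    have : (IsCMField.complexConj F) • ((p : 𝓞 F)) = (p : 𝓞 F) := by
      simpa only [MulSemiringAction.toRingHom_apply] using map_natCast (MulSemiringAction.toRingHom _ (𝓞 F) (IsCMField.complexConj F)) p
    rw [← this]
    exact Ideal.smul_mem_pointwise_smul_iff.mpr hpw
  -- conjugation on elements: `(c • b : 𝓞 F) = c b` and `c • b ∈ 𝔮 ↔ b ∈ 𝔭`, `b ∈ 𝔮 ↔ c • b ∈ 𝔭`
  have hconj_coe : ∀ b : 𝓞 F, (((IsCMField.complexConj F) • b : 𝓞 F) : F) = (IsCMField.complexConj F) (b : F) := fun _ => rfl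
  have hconj_conj : ∀ b : 𝓞 F, (IsCMField.complexConj F) • ((IsCMField.complexConj F) • b) = b := fun b => by
    apply RingOfIntegers.ext
    rw [hconj_coe, hconj_coe, IsCMField.complexConj_apply_apply]
  have hmem𝔮 : ∀ b : 𝓞 F, (IsCMField.complexConj F) • b ∈ 𝔮 ↔ b ∈ 𝔭 := fun b => by
    rw [h𝔮𝔭]; exact Ideal.smul_mem_pointwise_smul_iff
  have hmem𝔭 : ∀ b : 𝓞 F, (IsCMField.complexConj F) • b ∈ 𝔭 ↔ b ∈ 𝔮 := fun b => by
    rw [← hmem𝔮, hconj_conj]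
  -- ===================== 1. IDEAL ARITHMETIC: `(p) = 𝔭 𝔮 𝔟`, `𝔟` coprime to `𝔭` and to `𝔮` =====================
  have h𝔭dvd : 𝔭 ∣ Ideal.span {(p : 𝓞 F)} := Ideal.dvd_span_singleton.mpr hpw
  obtain ⟨J₁, hJ₁⟩ := h𝔭dvd
  have h𝔮dvdJ₁ : 𝔮 ∣ J₁ := by
    have h : 𝔮 ∣ 𝔭 * J₁ := hJ₁ ▸ Ideal.dvd_span_singleton.mpr hp𝔮
    rcases (Ideal.prime_of_isPrime ((IsCMField.complexConj F) • w).ne_bot inferInstance).dvd_or_dvd h with h' | h'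
    · exact absurd (Ideal.IsMaximal.eq_of_le inferInstance (Ideal.IsPrime.ne_top inferInstance) (Ideal.dvd_iff_le.mp h')) h𝔭𝔮ne
    · exact h'
  obtain ⟨𝔟, h𝔟⟩ := h𝔮dvdJ₁
  have hfac : Ideal.span {(p : 𝓞 F)} = 𝔭 * 𝔮 * 𝔟 := by rw [hJ₁, h𝔟, mul_assoc]
  -- `𝔭 ∤ 𝔟`, `𝔮 ∤ 𝔟` (unramified), hence comaximal
  have h𝔭𝔟 : 𝔭 ⊔ 𝔟 = ⊤ := by
    by_contra hne
    have e : 𝔭 = 𝔭 ⊔ 𝔟 := Ideal.IsMaximal.eq_of_le inferInstance hne le_sup_left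
    have h𝔟le : 𝔟 ≤ 𝔭 := calc 𝔟 ≤ 𝔭 ⊔ 𝔟 := le_sup_right
      _ = 𝔭 := e.symm
    obtain ⟨𝔠, h𝔠⟩ := Ideal.dvd_iff_le.mpr h𝔟le
    exact hunr ⟨𝔮 * 𝔠, by rw [hfac, h𝔠]; ring⟩
  have h𝔮𝔟 : 𝔮 ⊔ 𝔟 = ⊤ := by
    by_contra hne
    have e : 𝔮 = 𝔮 ⊔ 𝔟 := Ideal.IsMaximal.eq_of_le inferInstance hne le_sup_left
    have h𝔟le : 𝔟 ≤ 𝔮 := calc 𝔟 ≤ 𝔮 ⊔ 𝔟 := le_sup_right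
      _ = 𝔮 := e.symm
    obtain ⟨𝔠, h𝔠⟩ := Ideal.dvd_iff_le.mpr h𝔟le
    exact hunr' ⟨𝔭 * 𝔠, by rw [hfac, h𝔠]; ring⟩
  have h𝔭𝔮 : 𝔭 ⊔ 𝔮 = ⊤ := Ideal.IsMaximal.coprime_of_ne inferInstance inferInstance h𝔭𝔮ne
  -- `p ∈ 𝔟` and `p ∈ 𝔭 * 𝔮`
  have hp𝔟 : (p : 𝓞 F) ∈ 𝔟 := Ideal.dvd_span_singleton.mp ⟨𝔭 * 𝔮, by rw [hfac]; ring⟩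
  have hp𝔭𝔮 : (p : 𝓞 F) ∈ 𝔭 * 𝔮 := Ideal.dvd_span_singleton.mp ⟨𝔟, hfac⟩
  -- powers of comaximal ideals are comaximal
  have hcop : ∀ (I J : Ideal (𝓞 F)) (m n : ℕ), I ⊔ J = ⊤ → I ^ m ⊔ J ^ n = ⊤ := fun I J m n h =>
    Ideal.isCoprime_iff_sup_eq.mp (IsCoprime.pow (m := m) (n := n) (Ideal.isCoprime_iff_sup_eq.mpr h))
  -- ===================== 2. THE LEG `c`: kernel `A″[𝔭]` on ALL `T`-points, finite, flat; the endomorphisms `b_a` of `B` =====================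
  obtain ⟨m, E, hE, Pm, Qm, N, hN, hP, hQ, hQP, hPQ, hspan, -, -⟩ :=
    Literature.NumberTheory.NumberFields.SerrePresentation.exists_serrePresentation_of_ideal 𝔭 w.ne_bot
  have hN𝔭 : ((N : ℕ) : 𝓞 F) ∈ 𝔭 := natCast_mem_of_quasiInverse Pm Qm hQP hspan
  have hkerc : ∀ ⦃T : Over (Spec (.of Ω))⦄ (t : T ⟶ A''.X), t ≫ c = 1 ↔ ∀ a ∈ 𝔭, t ≫ act''.i a = 1 :=
    fun T t => comp_eq_one_iff_forall_mem_of_forall_points_of_charZero act'' E hE Pm Qm c hN hP hQ hQP hPQ hspan h2 t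
  haveI hcfin : IsFinite c.left := isFinite_left_of_surjective_of_forall_points act'' c hN hN𝔭 (fun Pt hPt => (h2 Pt).1 hPt)
  haveI hcflat : Flat c.left := flat_left_of_isFinite_of_surjective c
  -- the common endomorphisms `b_a` and their laws (cancel the epimorphism `c`)
  choose bB hbq hbc using h4
  have hb_one : bB 1 = 𝟙 B.X := by
    apply A''.cancel_left_of_flat_surjective c
    rw [← hbc, act''.i_one, Category.id_comp, Category.comp_id]
  have hb_add : ∀ a b, bB (a + b) = bB a * bB b := fun a b => by
    apply A''.cancel_left_of_flat_surjective c
    rw [← hbc, act''.i_add, MonObj.mul_comp, hbc, hbc, MonObj.comp_mul]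
  haveI hbmon : ∀ a, IsMonHom (bB a) := fun a => by
    haveI := act''.isMonHom a
    exact A''.isMonHom_of_comp_eq c (act''.i a ≫ c) (hbc a).symm
  -- the dual endomorphisms `b_a^∨` of `B̂` and their laws
  have hbd_mon : ∀ a, IsMonHom (DualPair.dualIsogenyOver (bB a) DB DB) := fun a =>
    DualPair.isMonHom_dualIsogenyOver (bB a) DB DB hDB hDB
  have hbd_one : DualPair.dualIsogenyOver (bB 1) DB DB = 𝟙 _ :=
    (DualPair.dualIsogenyOver_congr DB DB hb_one).trans (DualPair.dualIsogenyOver_id' DB hDB)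
  have hbd_add : ∀ a b, DualPair.dualIsogenyOver (bB (a + b)) DB DB =
      DualPair.dualIsogenyOver (bB a) DB DB * DualPair.dualIsogenyOver (bB b) DB DB := fun a b => by
    haveI : IsMonHom (bB a * bB b) := by rw [← hb_add]; infer_instance
    exact (DualPair.dualIsogenyOver_congr DB DB (hb_add a b)).trans (DualPair.dualIsogenyOver_mul DB DB hDB (bB a) (bB b))
  -- `c^∨` and `q^∨` are equivariant for the dual actions
  have hcd_eq : ∀ a, (haveI := act''.isMonHom a;
      DualPair.dualIsogenyOver (bB a) DB DB ≫ DualPair.dualIsogenyOver c D'' DB =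
        DualPair.dualIsogenyOver c D'' DB ≫ DualPair.dualIsogenyOver (act''.i a) D'' D'') := fun a => by
    haveI := act''.isMonHom a
    rw [← DualPair.dualIsogenyOver_comp c (bB a) D'' DB DB, ← DualPair.dualIsogenyOver_comp (act''.i a) c D'' D'' DB]
    exact DualPair.dualIsogenyOver_congr D'' DB (hbc a).symm
  have hqd_eq : ∀ a, (haveI := act.isMonHom a;
      DualPair.dualIsogenyOver (bB a) DB DB ≫ DualPair.dualIsogenyOver q D DB =
        DualPair.dualIsogenyOver q D DB ≫ DualPair.dualIsogenyOver (act.i a) D D) := fun a => by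
    haveI := act.isMonHom a
    rw [← DualPair.dualIsogenyOver_comp q (bB a) D DB DB, ← DualPair.dualIsogenyOver_comp (act.i a) q D D DB]
    exact DualPair.dualIsogenyOver_congr D DB (hbq a).symm
  -- `d : B → A″` with `c ≫ d = [p]`, `d ≫ c = [p]`, so that `c^∨ ≫ d^∨ = [p]` (right cancellation of `c^∨`)
  have hker_p : ∀ ⦃T : Over (Spec (.of Ω))⦄ (t : T ⟶ A''.X), t ≫ c = 1 → t ≫ A''.mulN p = 1 := fun T t ht => by
    have h := (hkerc t).1 ht (p : 𝓞 F) hpw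
    rw [comp_i_natCast] at h
    rw [mulN_def, MonObj.comp_pow, Category.comp_id]
    exact h
  haveI : IsMonHom (A''.mulN p) := A''.isMonHom_mulN p
  haveI : IsMonHom (B.mulN p) := B.isMonHom_mulN p
  obtain ⟨d, hcd_p, -⟩ := A''.existsUnique_comp_eq_of_forall_comp_eq_one c (A''.mulN p) hker_p
  haveI hdmon : IsMonHom d := A''.isMonHom_of_comp_eq c (A''.mulN p) hcd_p
  have hdc_p : d ≫ c = B.mulN p := by
    apply A''.cancel_left_of_flat_surjective c
    rw [← Category.assoc, hcd_p, mulN_def, mulN_def]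
    exact (A''.comp_pow_id_eq_pow_id_comp c p).symm
  have hcd_dual : DualPair.dualIsogenyOver c D'' DB ≫ DualPair.dualIsogenyOver d DB D'' = (𝟙 DB.hat.X) ^ p := by
    rw [← DualPair.dualIsogenyOver_comp d c DB D'' DB, DualPair.dualIsogenyOver_congr DB DB (h₂ := B.isMonHom_mulN p) hdc_p,
      DB.dualIsogenyOver_mulN hDB p, mulN_def]
  -- ROSATI FOR `λ_B`: `b_{b'} ≫ λ_B = λ_B ≫ b_b^∨` for `b' = conj b` (cancel `c` on the left, `c^∨` on the right)
  have hrosB : ∀ b b' : 𝓞 F, (b' : F) = (IsCMField.complexConj F) (b : F) →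
      bB b' ≫ lamB = lamB ≫ DualPair.dualIsogenyOver (bB b) DB DB := fun b b' hbb' => by
    haveI := act''.isMonHom b
    haveI := hbd_mon b
    haveI : IsMonHom (DualPair.dualIsogenyOver (act''.i b) D'' D'') := DualPair.isMonHom_dualIsogenyOver (act''.i b) D'' D'' hD'' hD''
    have l1 : c ≫ (bB b' ≫ lamB) ≫ DualPair.dualIsogenyOver c D'' DB =
        pol''.lam ≫ DualPair.dualIsogenyOver (act''.i b) D'' D'' ≫ D''.hat.mulN p := by
      rw [Category.assoc, ← Category.assoc c (bB b'), ← hbc b', Category.assoc, h3'', ← Category.assoc, hros'' b b' hbb', Category.assoc]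
    have l2 : c ≫ (lamB ≫ DualPair.dualIsogenyOver (bB b) DB DB) ≫ DualPair.dualIsogenyOver c D'' DB =
        pol''.lam ≫ DualPair.dualIsogenyOver (act''.i b) D'' D'' ≫ D''.hat.mulN p := by
      rw [Category.assoc, hcd_eq b, reassoc_of% h3'', mulN_def,
        D''.hat.comp_pow_id_eq_pow_id_comp (DualPair.dualIsogenyOver (act''.i b) D'' D'') p]
    have k2 : (bB b' ≫ lamB) ≫ DualPair.dualIsogenyOver c D'' DB = (lamB ≫ DualPair.dualIsogenyOver (bB b) DB DB) ≫ DualPair.dualIsogenyOver c D'' DB :=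
      A''.cancel_left_of_flat_surjective c (l1.trans l2.symm)
    exact B.cancel_right_of_comp_eq_pow_id (DualPair.dualIsogenyOver c D'' DB) (DualPair.dualIsogenyOver d DB D'') hp.ne_zero hcd_dual
      (bB b' ≫ lamB) (lamB ≫ DualPair.dualIsogenyOver (bB b) DB DB) k2
  -- `Ker c^∨` IS KILLED BY `b(𝔭)^∨`: for `r ∈ 𝔭`, `ι″(r)` descends through `c` to `g_r` with `g_r ≫ c = b_r`, so `b_r^∨ = c^∨ ≫ g_r^∨`
  have hkercd : ∀ ⦃T : Over (Spec (.of Ω))⦄ (z : T ⟶ DB.hat.X), z ≫ DualPair.dualIsogenyOver c D'' DB = 1 →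
      ∀ r ∈ 𝔭, z ≫ DualPair.dualIsogenyOver (bB r) DB DB = 1 := fun T z hz r hr => by
    haveI := act''.isMonHom r
    have hker_r : ∀ ⦃T : Over (Spec (.of Ω))⦄ (t : T ⟶ A''.X), t ≫ c = 1 → t ≫ act''.i r = 1 := fun T t ht => (hkerc t).1 ht r hr
    obtain ⟨g, hcg, -⟩ := A''.existsUnique_comp_eq_of_forall_comp_eq_one c (act''.i r) hker_r
    haveI hgmon : IsMonHom g := A''.isMonHom_of_comp_eq c (act''.i r) hcg
    have hgc : g ≫ c = bB r := by
      apply A''.cancel_left_of_flat_surjective c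
      rw [← Category.assoc, hcg, hbc]
    haveI : IsMonHom (DualPair.dualIsogenyOver g DB D'') := DualPair.isMonHom_dualIsogenyOver g DB D'' hD'' hDB
    rw [← DualPair.dualIsogenyOver_congr DB DB (h₁ := inferInstance) hgc, DualPair.dualIsogenyOver_comp g c DB D'' DB, ← Category.assoc, hz,
      MonObj.one_comp]
  -- ===================== 3. `K ⊆ A[p]`: exponent `p·d` by (r3) + (P-1), order a power of `p` by the degree clause + the ★ count =====================
  obtain ⟨dd, ν, hνmon, hcopr, hν⟩ := hν
  haveI := hνmon
  have hnp : 0 < Module.finrank ℚ F := Module.finrank_pos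
  have hcnt : Nat.card {P : A''.toAffine.toAbelianVariety.Points Ω // ∀ a ∈ 𝔭, P ≫ act''.i a = 1} = Ideal.absNorm 𝔭 ^ 2 := by
    have h := act''.natCard_idealTorsion_algPoints_eq_absNorm_pow_of_isOfRelDim σ hA'' 𝔭 w.ne_bot
    rwa [RingOfIntegers.rank, Nat.mul_div_cancel _ hnp] at h
  have hcardK : Nat.card ↥K = Ideal.absNorm 𝔭 ^ 2 := hdeg.trans hcnt
  have hnorm_dvd : Ideal.absNorm 𝔭 ^ 2 ∣ p ^ (2 * Module.finrank ℚ F) := by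
    have h1' : Ideal.absNorm 𝔭 ∣ Ideal.absNorm (Ideal.span {(p : 𝓞 F)}) :=
      Ideal.absNorm_dvd_absNorm_of_le ((Ideal.span_singleton_le_iff_mem _).mpr hpw)
    rw [Ideal.absNorm_span_singleton, ← map_natCast (algebraMap ℤ (𝓞 F)) p, Algebra.norm_algebraMap, Int.natAbs_pow,
      Int.natAbs_natCast, RingOfIntegers.rank] at h1'
    rw [pow_mul']
    exact pow_dvd_pow_of_dvd h1' 2
  have hKp : ∀ x : specOver Ω Ω ⟶ A.X, x ∈ K → x ^ p = 1 := by
    intro x hx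
    have hq1 : x ≫ q = 1 := (h1 x).2 hx
    have hlp : (x ≫ pol.lam) ^ p = 1 := by
      have e : x ≫ pol.lam ≫ D.hat.mulN p = 1 := by rw [← h3, ← Category.assoc, hq1, MonObj.one_comp]
      rwa [mulN_def, MonObj.comp_pow, Category.comp_id, MonObj.comp_pow] at e
    have hxpd : x ^ (dd * p) = 1 := by
      have e2 : x ≫ pol.lam ≫ ν = x ^ dd := by rw [hν, mulN_def, MonObj.comp_pow, Category.comp_id]
      rw [pow_mul, ← e2, ← Category.assoc, ← MonObj.pow_comp, hlp, MonObj.one_comp]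
    have hxcard : x ^ (p * p ^ (2 * Module.finrank ℚ F)) = 1 := by
      have hK1 : x ^ Nat.card ↥K = 1 := by
        have := pow_card_eq_one' (G := ↥K) (x := ⟨x, hx⟩)
        exact congrArg Subtype.val this
      rw [hcardK] at hK1
      obtain ⟨k, hk⟩ := hnorm_dvd
      rw [mul_comm, hk, pow_mul, pow_mul, hK1, one_pow, one_pow]
    -- `x ^ p` is killed by `dd` and by `p ^ 2n`, which are coprime
    have hg : Nat.gcd dd (p ^ (2 * Module.finrank ℚ F)) = 1 := Nat.Coprime.pow_right _ hcopr.symm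
    have hgcd : (x ^ p) ^ Nat.gcd dd (p ^ (2 * Module.finrank ℚ F)) = 1 :=
      pow_gcd_eq_one.mpr ⟨by rw [← pow_mul, mul_comm, hxpd], by rw [← pow_mul, hxcard]⟩
    rwa [hg, pow_one] at hgcd
  -- ===================== 4. THE BANAL LEMMA: `K ∩ A[𝔟] = 1` =====================
  haveI : LocallyOfFiniteType A''.X.hom := (inferInstance : LocallyOfFiniteType A''.toAffine.toAbelianVariety.X.hom)
  have hp0 : (p : Ω) ≠ 0 := Nat.cast_ne_zero.mpr hp.ne_zero
  -- `(𝔭𝔮)^k · 𝔟^k = (p^k)`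
  have hfacpow : ∀ k : ℕ, (𝔭 * 𝔮) ^ k * 𝔟 ^ k ≤ Ideal.span {((p ^ k : ℕ) : 𝓞 F)} := fun k => by
    rw [← mul_pow, ← hfac, Ideal.span_singleton_pow, Nat.cast_pow]
  have h𝔭𝔮𝔟0 : 𝔭 * 𝔮 ⊔ 𝔟 = ⊤ := Ideal.isCoprime_iff_sup_eq.mp
    (IsCoprime.mul_left (Ideal.isCoprime_iff_sup_eq.mpr h𝔭𝔟) (Ideal.isCoprime_iff_sup_eq.mpr h𝔮𝔟))
  have h𝔭𝔮𝔟 : ∀ m n : ℕ, (𝔭 * 𝔮) ^ m ⊔ 𝔟 ^ n = ⊤ := fun m n => hcop _ _ m n h𝔭𝔮𝔟0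
  have hp3 : p ^ 3 = p ^ 2 * p := by ring
  have hBANAL : ∀ z : specOver Ω Ω ⟶ A.X, z ∈ K → (∀ b ∈ 𝔟, z ≫ act.i b = 1) → z = 1 := by
    intro z hz hz𝔟
    have hzq : z ≫ q = 1 := (h1 z).2 hz
    have hzp : z ^ p = 1 := hKp z hz
    -- (a) a `p`-th root `t` of `z` killed by `𝔟²`
    obtain ⟨t₀, ht₀⟩ := A.toAffine.toAbelianVariety.pow_surjective_of_isAlgClosed p hp0 z
    have ht₀p : (t₀ : specOver Ω Ω ⟶ A.X) ^ p = z := ht₀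
    obtain ⟨u₂, hu₂, v₂, hv₂, huv₂⟩ := Submodule.mem_sup.mp ((Ideal.eq_top_iff_one _).mp (h𝔭𝔮𝔟 2 2))
    have ht₀M : ∀ m ∈ Ideal.span {((p ^ 2 : ℕ) : 𝓞 F)}, (t₀ : specOver Ω Ω ⟶ A.X) ≫ act.i m = 1 :=
      forall_mem_span_natCast_of_pow_eq_one act t₀ (by rw [sq, pow_mul, ht₀p, hzp])
    set t : specOver Ω Ω ⟶ A.X := (t₀ : specOver Ω Ω ⟶ A.X) ≫ act.i u₂ with htdef
    clear_value t
    have htp : t ^ p = z := by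
      haveI := act.isMonHom u₂
      rw [htdef, ← MonObj.pow_comp, ht₀p]
      exact comp_i_eq_self_of_sub_one_mem act z hz𝔟 (by
        have : u₂ - 1 = -v₂ := by rw [← huv₂]; ring
        rw [this]; exact Submodule.neg_mem _ (Ideal.pow_le_self two_ne_zero hv₂))
    have ht𝔟 : ∀ b ∈ 𝔟 ^ 2, t ≫ act.i b = 1 := by
      rw [htdef]; exact forall_mem_comp_i_comp_i_eq_one act t₀ ht₀M (hfacpow 2) hu₂
    -- (b) `y ∈ A″(Ω)` with `y ≫ c = t ≫ q`, killed by `𝔟³`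
    obtain ⟨y₀, hy₀⟩ := AlgPoints.map_surjective_of_surjective_of_isAlgClosed' (L := Ω)
      (X := A''.toAffine.toAbelianVariety.X) (Y := B.toAffine.toAbelianVariety.X) c (t ≫ q)
    have hy₀c : (y₀ : specOver Ω Ω ⟶ A''.X) ≫ c = t ≫ q := hy₀
    have hy₀p3 : (y₀ : specOver Ω Ω ⟶ A''.X) ^ (p ^ 3) = 1 := by
      have e1 : ((y₀ : specOver Ω Ω ⟶ A''.X) ^ (p ^ 2)) ≫ c = 1 := by
        rw [MonObj.pow_comp, hy₀c, ← MonObj.pow_comp, sq, pow_mul, htp, hzp, MonObj.one_comp]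
      have e2 := (hkerc _).1 e1 (p : 𝓞 F) hpw
      rw [comp_i_natCast, ← pow_mul] at e2
      rwa [hp3]
    have hy₀M : ∀ m ∈ Ideal.span {((p ^ 3 : ℕ) : 𝓞 F)}, (y₀ : specOver Ω Ω ⟶ A''.X) ≫ act''.i m = 1 :=
      forall_mem_span_natCast_of_pow_eq_one act'' y₀ hy₀p3
    obtain ⟨u₃, hu₃, v₃, hv₃, huv₃⟩ := Submodule.mem_sup.mp ((Ideal.eq_top_iff_one _).mp (h𝔭𝔮𝔟 3 3))
    set y : specOver Ω Ω ⟶ A''.X := (y₀ : specOver Ω Ω ⟶ A''.X) ≫ act''.i u₃ with hydef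
    clear_value y
    have hyc : y ≫ c = t ≫ q := by
      rw [hydef, Category.assoc, hbc, ← Category.assoc, hy₀c, Category.assoc, ← hbq, ← Category.assoc,
        comp_i_eq_self_of_sub_one_mem act t ht𝔟 (by
          have : u₃ - 1 = -v₃ := by rw [← huv₃]; ring
          rw [this]; exact Submodule.neg_mem _ (Ideal.pow_le_pow_right (by norm_num) hv₃))]
    have hy𝔟 : ∀ b ∈ 𝔟 ^ 3, y ≫ act''.i b = 1 := by
      rw [hydef]; exact forall_mem_comp_i_comp_i_eq_one act'' y₀ hy₀M (hfacpow 3) hu₃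
    -- (c) `y ^ p = 1`: `y^p ∈ Ker c` is killed by `𝔭` and by `𝔟³`
    have hyp : y ^ p = 1 := by
      have e1 : (y ^ p) ≫ c = 1 := by rw [MonObj.pow_comp, hyc, ← MonObj.pow_comp, htp, hzq]
      have hIJ : 𝔭 ⊔ 𝔟 ^ 3 = ⊤ := by have h := hcop 𝔭 𝔟 1 3 h𝔭𝔟; rwa [pow_one] at h
      refine comp_eq_one_of_forall_mem_sup_eq_top act'' (y ^ p) ((hkerc _).1 e1) (fun b hb => ?_) hIJ
      haveI := act''.isMonHom b
      rw [MonObj.pow_comp, hy𝔟 b hb, one_pow]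
    -- (d) `ζ := y₁ ≫ c ≫ λ_B` for a `p`-th root `y₁` of `y`; `ζ^p = t ≫ q ≫ λ_B` lies in `Ker c^∨`
    obtain ⟨y₁, hy₁⟩ := A''.toAffine.toAbelianVariety.pow_surjective_of_isAlgClosed p hp0 y
    have hy₁p : (y₁ : specOver Ω Ω ⟶ A''.X) ^ p = y := hy₁
    set ζ : specOver Ω Ω ⟶ DB.hat.X := (y₁ : specOver Ω Ω ⟶ A''.X) ≫ c ≫ lamB with hζdef
    clear_value ζ
    have hζp : ζ ^ p = t ≫ q ≫ lamB := by
      rw [hζdef, ← Category.assoc, ← MonObj.pow_comp, ← MonObj.pow_comp, hy₁p, hyc, Category.assoc]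
    have hζker : (ζ ^ p) ≫ DualPair.dualIsogenyOver c D'' DB = 1 := by
      rw [hζdef, ← Category.assoc, ← MonObj.pow_comp, ← MonObj.pow_comp, hy₁p, Category.assoc, Category.assoc, h3'',
        mulN_def, MonObj.comp_pow, Category.comp_id, MonObj.comp_pow, ← MonObj.pow_comp, hyp, MonObj.one_comp]
    -- (e) `ζ^p` is killed by `b(𝔭)^∨` (it lies in `Ker c^∨`) and by `b(v)^∨` whenever `conj v ∈ 𝔟²` (Rosati for `λ_B`): so `ζ^p = 1`
    have hkill1 : ∀ r ∈ 𝔭, (ζ ^ p) ≫ DualPair.dualIsogenyOver (bB r) DB DB = 1 := hkercd (ζ ^ p) hζker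
    have hkill2 : ∀ v : 𝓞 F, (IsCMField.complexConj F) • v ∈ 𝔟 ^ 2 → (ζ ^ p) ≫ DualPair.dualIsogenyOver (bB v) DB DB = 1 := fun v hv => by
      have e3 : (t ≫ q ≫ lamB) ≫ DualPair.dualIsogenyOver (bB v) DB DB = (t ≫ act.i ((IsCMField.complexConj F) • v)) ≫ q ≫ lamB := by
        simp only [Category.assoc]
        rw [← hrosB v ((IsCMField.complexConj F) • v) (hconj_coe v), ← Category.assoc q, ← hbq, Category.assoc]
      rw [hζp, e3, ht𝔟 _ hv, MonObj.one_comp]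
    have hζ1 : ζ ^ p = 1 := by
      -- `1 = β₂ + gg`, `β₂ ∈ 𝔟²`, `gg ∈ 𝔮`; conjugate: `1 = c•β₂ + c•gg` with `c•(c•β₂) = β₂ ∈ 𝔟²` and `c•gg ∈ 𝔭`
      obtain ⟨β₂, hβ₂, gg, hgg, hβg⟩ := Submodule.mem_sup.mp ((Ideal.eq_top_iff_one _).mp (hcop 𝔟 𝔮 2 1 ((sup_comm 𝔟 𝔮).trans h𝔮𝔟)))
      rw [pow_one] at hgg
      have hsum : (IsCMField.complexConj F) • gg + (IsCMField.complexConj F) • β₂ = 1 := by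
        rw [← smul_add, add_comm, hβg, smul_one]
      have e : (ζ ^ p) ≫ DualPair.dualIsogenyOver (bB 1) DB DB = ζ ^ p := by rw [hbd_one, Category.comp_id]
      rw [← e, ← hsum, hbd_add, MonObj.comp_mul, hkill1 _ ((hmem𝔭 gg).2 hgg), hkill2 _ (by rw [hconj_conj]; exact hβ₂), mul_one]
    -- (f) conclude: `z ≫ λ = (t ≫ λ)^p = ζ^p ≫ q^∨ = 1`, and `λ` kills no `p`-torsion point
    have hzlam : z ≫ pol.lam = 1 := by
      have e1 : z ≫ pol.lam = (ζ ^ p) ≫ DualPair.dualIsogenyOver q D DB := by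
        rw [hζp]
        simp only [Category.assoc]
        rw [h3, ← htp, MonObj.pow_comp, mulN_def, MonObj.comp_pow, Category.comp_id, MonObj.comp_pow]
      rw [e1, hζ1, MonObj.one_comp]
    have hzdd : z ^ dd = 1 := by
      have e2 : z ≫ pol.lam ≫ ν = z ^ dd := by rw [hν, mulN_def, MonObj.comp_pow, Category.comp_id]
      rw [← e2, ← Category.assoc, hzlam, MonObj.one_comp]
    have hg1 : Nat.gcd dd p = 1 := hcopr.symm
    have hgcd : z ^ Nat.gcd dd p = 1 := pow_gcd_eq_one.mpr ⟨hzdd, hzp⟩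
    rwa [hg1, pow_one] at hgcd
  -- ===================== 5. CONCLUSION: `x = x_𝔟 · (x / x_𝔟)`, `x_𝔟 := x ≫ ι(u) ∈ K ∩ A[𝔟]` trivial, `x / x_𝔟` killed by `𝔭𝔮` =====================
  intro x hx a ha
  change (x : specOver Ω Ω ⟶ A.X) ≫ act.i a = 1
  obtain ⟨u, hu, v, hv, huv⟩ := Submodule.mem_sup.mp ((Ideal.eq_top_iff_one _).mp h𝔭𝔮𝔟0)
  have hxp : (x : specOver Ω Ω ⟶ A.X) ^ p = 1 := hKp x hx
  have hxM : ∀ m ∈ Ideal.span {((p ^ 1 : ℕ) : 𝓞 F)}, (x : specOver Ω Ω ⟶ A.X) ≫ act.i m = 1 :=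
    forall_mem_span_natCast_of_pow_eq_one act x (by rw [pow_one]; exact hxp)
  have hq1 : (x : specOver Ω Ω ⟶ A.X) ≫ q = 1 := (h1 x).2 hx
  have hxuK : (x : specOver Ω Ω ⟶ A.X) ≫ act.i u ∈ K := by
    apply (h1 _).1
    change ((x : specOver Ω Ω ⟶ A.X) ≫ act.i u) ≫ q = 1
    rw [Category.assoc, hbq, ← Category.assoc, hq1, MonObj.one_comp]
  have hxu𝔟 : ∀ b ∈ 𝔟, ((x : specOver Ω Ω ⟶ A.X) ≫ act.i u) ≫ act.i b = 1 := by
    have h := forall_mem_comp_i_comp_i_eq_one act x hxM (hfacpow 1) (by rw [pow_one]; exact hu)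
    simpa only [pow_one] using h
  have hxu : (x : specOver Ω Ω ⟶ A.X) ≫ act.i u = 1 := hBANAL _ hxuK hxu𝔟
  have hav : (x : specOver Ω Ω ⟶ A.X) ≫ act.i (a * v) = 1 :=
    hxM _ (by have h := hfacpow 1; rw [pow_one, pow_one] at h; exact h (Ideal.mul_mem_mul ha hv))
  haveI := act.isMonHom a
  calc (x : specOver Ω Ω ⟶ A.X) ≫ act.i a = x ≫ act.i (a * u + a * v) := by rw [← mul_add, huv, mul_one]
    _ = 1 := by rw [act.comp_i_add, act.comp_i_mul, hxu, hav, mul_one, MonObj.one_comp]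

set_option maxHeartbeats 400000 in
/-- **COROLLARY (ED. 2) — THE `𝔭_{c•w}`-PRIMARY PART OF THE ROOF KERNEL IS THE LINE: `K[𝔭̄^∞] = L`.**  Same roof as `isIdealTorsion_mul_of_roof`, PLUS the line
clause of the letter `RoofLink` (`P ∈ L ↔ P ∈ K ∧ ι(𝔭̄)P = 1`): every `P ∈ K` killed by some power `𝔭̄^n` already lies in `L` — since `K ⊆ A[𝔭𝔭̄]` and
`𝔭̄ ⊆ 𝔭𝔭̄ + 𝔭̄^{n+1}` (`𝔭 ⊔ 𝔭̄^n = 𝒪`).  The input of (ρ1)'s exactness-by-rank on the `c•w`-dock. [cite: Liu2021, Prop. D.8 (p. 135), pp. 136–138]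
[cite: MumfordAV1970, §7 Thm. 4 (p. 72), §23 (p. 231)] -/
theorem mem_of_forall_mem_pow_of_roof
    (w : HeightOneSpectrum (𝓞 F)) (hw : (IsCMField.complexConj F) • w ≠ w)
    {p : ℕ} (hp : p.Prime) (hpw : (p : 𝓞 F) ∈ w.asIdeal)
    (hunr : ¬ w.asIdeal ^ 2 ∣ Ideal.span {(p : 𝓞 F)}) (hunr' : ¬ ((IsCMField.complexConj F) • w).asIdeal ^ 2 ∣ Ideal.span {(p : 𝓞 F)})
    (σ : Ω →+* ℂ) (hA'' : A''.IsOfRelDim (Module.finrank ℚ F))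
    (hDB : Nonempty ((Scheme.Modules.pullback DB.unitHatSlice).obj DB.P ≅ SheafOfModules.unit _))
    (K : Subgroup (A.toAffine.toAbelianVariety.Points Ω))
    (h1 : ∀ P : A.toAffine.toAbelianVariety.Points Ω,
      (AlgPoints.map q P : B.toAffine.toAbelianVariety.Points Ω) = 1 ↔ P ∈ K)
    (h2 : ∀ P : A''.toAffine.toAbelianVariety.Points Ω,
      (AlgPoints.map c P : B.toAffine.toAbelianVariety.Points Ω) = 1 ↔
        ∀ a ∈ w.asIdeal, (AlgPoints.map (act''.i a) P : A''.toAffine.toAbelianVariety.Points Ω) = 1)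
    (h2s : Function.Surjective c.left.base)
    (h3 : q ≫ lamB ≫ DualPair.dualIsogenyOver q D DB = pol.lam ≫ D.hat.mulN p)
    (h3'' : c ≫ lamB ≫ DualPair.dualIsogenyOver c D'' DB = pol''.lam ≫ D''.hat.mulN p)
    (h4 : ∀ a : 𝓞 F, ∃ b : B.X ⟶ B.X, act.i a ≫ q = q ≫ b ∧ act''.i a ≫ c = c ≫ b)
    (hros'' : ∀ b b' : 𝓞 F, (b' : F) = (IsCMField.complexConj F) (b : F) →
      haveI := act''.isMonHom b
      act''.i b' ≫ pol''.lam = pol''.lam ≫ DualPair.dualIsogenyOver (act''.i b) D'' D'')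
    (hν : ∃ (d : ℕ) (ν : D.hat.X ⟶ A.X), IsMonHom ν ∧ p.Coprime d ∧ pol.lam ≫ ν = A.mulN d)
    (hdeg : Nat.card ↥K = Nat.card {P : A''.toAffine.toAbelianVariety.Points Ω //
      ∀ a ∈ w.asIdeal, (AlgPoints.map (act''.i a) P : A''.toAffine.toAbelianVariety.Points Ω) = 1})
    -- the LINE CLAUSE of `RoofLink`
    (L : Subgroup (A.toAffine.toAbelianVariety.Points Ω))
    (hL : ∀ P, P ∈ L ↔ P ∈ K ∧ ∀ a ∈ ((IsCMField.complexConj F) • w).asIdeal,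
      (AlgPoints.map (act.i a) P : A.toAffine.toAbelianVariety.Points Ω) = 1)
    (n : ℕ) :
    ∀ P ∈ K, (∀ a ∈ ((IsCMField.complexConj F) • w).asIdeal ^ n,
        (AlgPoints.map (act.i a) P : A.toAffine.toAbelianVariety.Points Ω) = 1) → P ∈ L := by
  intro P hP hPn
  have hr0 := isIdealTorsion_mul_of_roof act act'' D pol D'' pol'' DB lamB q c w hw hp hpw hunr hunr' σ hA'' hDB K h1 h2 h2s h3 h3''
    h4 hros'' hν hdeg P hP
  refine (hL P).2 ⟨hP, fun a ha => ?_⟩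
  change (P : specOver Ω Ω ⟶ A.X) ≫ act.i a = 1
  -- `𝔭 ⊔ 𝔭̄^n = 𝒪`: `1 = u + v`, so `a = a u + a v` with `a u ∈ 𝔭𝔭̄` and `a v ∈ 𝔭̄^n · 𝔭̄ ⊆ 𝔭̄^n`
  have hne : w.asIdeal ≠ ((IsCMField.complexConj F) • w).asIdeal := fun h => hw (HeightOneSpectrum.ext h.symm)
  have hcopr : w.asIdeal ⊔ ((IsCMField.complexConj F) • w).asIdeal ^ n = ⊤ := by
    have h := Ideal.isCoprime_iff_sup_eq.mp
      (IsCoprime.pow (m := 1) (n := n) (Ideal.isCoprime_iff_sup_eq.mpr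
        (Ideal.IsMaximal.coprime_of_ne w.isMaximal ((IsCMField.complexConj F) • w).isMaximal hne)))
    rwa [pow_one] at h
  obtain ⟨u, hu, v, hv, huv⟩ := Submodule.mem_sup.mp ((Ideal.eq_top_iff_one _).mp hcopr)
  have hau : (P : specOver Ω Ω ⟶ A.X) ≫ act.i (a * u) = 1 :=
    hr0 _ (by rw [mul_comm a u]; exact Ideal.mul_mem_mul hu ha)
  have hav : (P : specOver Ω Ω ⟶ A.X) ≫ act.i (a * v) = 1 :=
    hPn _ (Ideal.mul_le_left (I := ((IsCMField.complexConj F) • w).asIdeal) (Ideal.mul_mem_mul ha hv))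
  calc (P : specOver Ω Ω ⟶ A.X) ≫ act.i a = P ≫ act.i (a * u + a * v) := by rw [← mul_add, huv, mul_one]
    _ = 1 := by rw [act.comp_i_add, hau, hav, mul_one]

omit [IsCMField F] [CharZero Ω] [IsMonHom q] in
set_option maxHeartbeats 400000 in
/-- (ED. 3) **THE ROOF KERNEL IS `ι`-STABLE**: for the roof `A —q→ B ←c— A″` with (r1) `Ker q(Ω) = K`, (r2) `Ker c(Ω) = A″[𝔭_w](Ω)` and `c` surjective, and
(r4) common endomorphisms `b_a` of `B` (`ι(a) ≫ q = q ≫ b_a`, `ι″(a) ≫ c = c ≫ b_a`): `ι(a)K ⊆ K`.  The point is that `b_a` is a HOMOMORPHISM — it is so after the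
faithfully flat `c` (`c` is finite flat surjective: its kernel is `A″[𝔭_w]` on all `T`-points, ★ KER-EQ), ★ `isMonHom_of_comp_eq` — so `(P ≫ ι(a)) ≫ q = (P ≫ q) ≫ b_a
= 1 ≫ b_a = 1`.  The stability input of the CRT splitting ★ `IdealTorsionPointsCoprimeSplitting` for `K`. [cite: MumfordAV1970, §7 Thm. 4 (p. 72)]
[cite: Shimura1998, §13.1 Thm. 1 (pp. 97–99)] -/
theorem map_i_mem_of_roof
    (w : HeightOneSpectrum (𝓞 F)) (K : Subgroup (A.toAffine.toAbelianVariety.Points Ω))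
    (h1 : ∀ P : A.toAffine.toAbelianVariety.Points Ω,
      (AlgPoints.map q P : B.toAffine.toAbelianVariety.Points Ω) = 1 ↔ P ∈ K)
    (h2 : ∀ P : A''.toAffine.toAbelianVariety.Points Ω,
      (AlgPoints.map c P : B.toAffine.toAbelianVariety.Points Ω) = 1 ↔
        ∀ a ∈ w.asIdeal, (AlgPoints.map (act''.i a) P : A''.toAffine.toAbelianVariety.Points Ω) = 1)
    (h2s : Function.Surjective c.left.base)
    (h4 : ∀ a : 𝓞 F, ∃ b : B.X ⟶ B.X, act.i a ≫ q = q ≫ b ∧ act''.i a ≫ c = c ≫ b) :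
    ∀ a : 𝓞 F, ∀ P ∈ K, (AlgPoints.map (act.i a) P : A.toAffine.toAbelianVariety.Points Ω) ∈ K := by
  classical
  haveI : IsCommMonObj A''.X := A''.isCommMonObj_of_isReduced_base
  haveI : IsCommMonObj B.X := B.isCommMonObj_of_isReduced_base
  haveI : Surjective c.left := ⟨h2s⟩
  set 𝔭 : Ideal (𝓞 F) := w.asIdeal with h𝔭def
  haveI : 𝔭.IsMaximal := w.isMaximal
  -- the leg `c`: kernel `A″[𝔭]` on all `T`-points, finite, flat (★ KER-EQ)
  obtain ⟨m, E, hE, Pm, Qm, N, hN, hP, hQ, hQP, hPQ, hspan, -, -⟩ :=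
    Literature.NumberTheory.NumberFields.SerrePresentation.exists_serrePresentation_of_ideal 𝔭 w.ne_bot
  have hN𝔭 : ((N : ℕ) : 𝓞 F) ∈ 𝔭 := natCast_mem_of_quasiInverse Pm Qm hQP hspan
  haveI hcfin : IsFinite c.left := isFinite_left_of_surjective_of_forall_points act'' c hN hN𝔭 (fun Pt hPt => (h2 Pt).1 hPt)
  haveI hcflat : Flat c.left := flat_left_of_isFinite_of_surjective c
  -- the common endomorphisms `b_a` are homomorphisms (cancel the faithfully flat `c`)
  choose bB hbq hbc using h4
  haveI hbmon : ∀ a, IsMonHom (bB a) := fun a => by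
    haveI := act''.isMonHom a
    exact A''.isMonHom_of_comp_eq c (act''.i a ≫ c) (hbc a).symm
  intro a x hx
  have hq1 : x ≫ q = 1 := (h1 x).2 hx
  refine (h1 _).1 ?_
  change (x ≫ act.i a) ≫ q = 1
  rw [Category.assoc, hbq, ← Category.assoc, hq1, MonObj.one_comp]

end Roof


end AbelianSchemeOver

end Literature.AlgebraicGeometry.AbelianSchemes

end
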